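import Literature.MathematicalPhysics.KineticTheory.LangevinChainKernelDensity
import Summits.AtomisticToContinuum.FouriersLaw.Theorems.BondHeatUncertaintyExtensiveSnapshotIrreversibilityEnergyWindowKernelDuhamelSplit

/-!
(SPLIT FOR THE 400-LINE CAP by the landing lane, hand-2 g30: this file = part 1 of 2; sequels `…BondHeatUncertaintyExtensiveSnapshotIrreversibilityEnergyWindowSkeletonWeights` import it in a chain; same namespace, all FQNs unchanged.)
# Crux `ExtensiveSnapshotIrreversibility` (stmt-AtomisticToContinuum-9121): skeleton weights

Cell decomp-a2c, lens «grading / quantitative ladder», generation 77, part R (critic row 1064,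
RULED order: «(I-s1) port → type (SWM) + BC7 → identities → glues → (I-s2) last»).  The record
beneath the kernel leaf S3 `KernelTemperatureLipschitz` is `S3 ⟸ (Dˢ) ∧ (G1) ∧ (G1*)` (parts M, P:
`kernelTemperatureLipschitz_of_smoothDuhamel`), with the quantitative cores (G1ᶜ) ⟹ (G1),
(G1*ᶜ) ⟹ (G1*) (part O).  The two gradient leaves (G1) `EqualTemperatureBathGradient` (departure /
Bismut side) and (G1*) `PerturbedKernelMomentumIBP` (arrival / integration-by-parts side) are ONE
mechanism: a Malliavin integration by parts along the bath-noise directions.  This file builds the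
FINITE-LEVEL ("skeleton") version of that mechanism over the tree's partial-Malliavin calculus
(`LangevinChainKernelDensity`: the level-`m` dyadic skeleton `x ∈ PairSkeleton m` of the two bath
Brownian motions, the remainder `r`, the skeleton flow map, its Jacobian and Gram matrices) and
types the single deep leaf both gradient leaves reduce to.

§1 (I-s1) The skeleton flow map AT TIME `s ∈ [0, 1]`, `E^{s}_{m,z,r}(x)` (`skelFlowMapAt`; the
tree's `skelFlowMap` is `s = 1`): `solMap s z (pairPath wp) = E^{s}_{m,z,R_m wp}(Ξ_m wp)`
(`pinnedChain_solMap_eq_skelFlowMapAt`), `C^∞` in the skeleton with derivative the variational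
solution at time `s` (`contDiff_skelFlowMapAt`, `fderiv_skelFlowMapAt_apply`), jointly measurable
(`measurable_skelFlowMapAt`, `measurable_fderiv_skelFlowMapAt_apply`), and — NEW, needed for the
departure side — JOINTLY `C^∞` IN (STARTING POINT, SKELETON)
(`contDiff_pinnedChainSolCurve_uncurry`,
`contDiff_skelFlowMapAt_uncurry`; the implicit-function theorem of `ForcedSmoothDependence` with
parameter space `PhaseSpace N × PairSkeleton m`, the forcing curve being affine in both), whence
`z ↦ solMap s z (pairPath wp)` is `C^∞` for EVERY path (`contDiff_solMap_pairPath`).  All PROVED.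
§2 The level-`m` objects at time `s` (definitions, every `fderiv` of a map proved smooth in §1):
Jacobian `J = skelJacAt` (`2N × 2·2^m`), NORMALISED Gram matrix `Γ = 2^{-m} J Jᵀ = skelGramAt`
(the reduced Malliavin matrix compressed to the level-`m` Cameron–Martin directions; the skeleton
coordinates are i.i.d. `N(0, 2^{-m})`), the Tikhonov-regularised inverse `(Γ + κ)⁻¹ = regInv Γ κ`
(a genuine inverse: `Γ + κ ≻ 0` for `κ > 0`, `posDef_skelGramAt_add_smul`, PROVED), the arrival
control `a = (Γ+κ)⁻¹ e_{p_b}` and field `u = Jᵀ a`, the departure vector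
`V = coords of ∂_z E^{s}(z)[e_{p_b}]`, control `a' = (Γ+κ)⁻¹ V`, field `u' = Jᵀ a'`, the Euclidean
divergence `skelDiv` and the level-`m` GAUSSIAN DIVERGENCE (finite-dimensional Skorokhod integral at
variance `2^{-m}`) `δ_m(u)(x) = Σ_j x_j u_j(x) − 2^{-m} div u(x)` (`skelSkorokhod`), and the two
REGULARISED SKELETON WEIGHTS `w = δ_m(u)` (`skelWeightArr`), `w' = δ_m(u')` (`skelWeightDep`).
Why these: for `g ∈ C¹_c`, Gaussian integration by parts in `x` at fixed remainder gives EXACTLY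
`E_z[(∂_{p_b} g)(X_s)] = E[(g∘E) w] + κ E[⟨∇g(X_s), a⟩]` and
`∂_{e_{p_b}} E_z[g(X_s)] = E[(g∘E) w'] + κ E[⟨∇g(X_s), a'⟩]` (`J(2^{-m}Jᵀa) = Γa = e_b − κa`):
no defect at finite level (the unregularised `κ = 0` identity is FALSE at fixed `m`, memo
SKELETON-OBSTRUCTION-g76 §1), and the `κ`-terms vanish as `m → ∞, κ → 0` by the tree's eventual
surjectivity at a FIXED level `m'` (`exists_forall_range_fderiv_skelFlowMap_eq_top`, to be ported
to time `s`, (I-s2)) and the Loewner monotonicity `Γ_{m'} ≤ Γ_m`, `m' ≤ m` (nested Cameron–Martin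
compressions), which bounds `|κa_{m,κ}| ≤ (κ⟨e,(Γ_{m'}+κ)⁻¹e⟩)^{1/2}` uniformly in `m ≥ m'`.
§3 The leaf (SWM) `SkeletonWeightMoments`: `L^q(wienerPair)`-moments of `w`, `w'` bounded by
`C s^{-b₀} e^{εH(z)}`, `b₀ < 1`, for every `q ≥ 2`, `ε > 0` (constant chosen right after `q, ε`),
for EVERY `κ > 0`, EVENTUALLY IN THE LEVEL `m` (threshold `m₁` after `q`, `z` AND `κ`) [OPEN ·
DEEP-L: at fixed `κ` dominated convergence along `Γ_m ↑ Γ_∞` makes the `κ`-uniform constant an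
inverse-moment bound for the LIMIT reduced Malliavin matrix of the chain — Kusuoka–Stroock / Norris
under the everywhere-Hörmander condition `V'' = 1 + 3βr² ≥ 1` — plus `L^q` bounds for the explicit
finite-dimensional divergence; NO finite-level small-ball estimate is asserted]; its finite-level
strengthening (SWMᶠ) `SkeletonWeightMomentsFiniteLevel` («`∃ m₁ ∀ κ`»; recorded, implies (SWM),
`skeletonWeightMoments_of_finiteLevel`; needed by nothing); the support leaf (JM)
`FlowJacobianMoment`: `L^q`-moments of the
derivative of the flow in the starting point along `e_{p_b}` bounded by `C e^{εH(z)}`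
[ATTACKABLE-M: energy estimate for the first-variation equation, `D²Φ ≥ ω₂²`, `|D³Φ[p]| ≲ |p| D²Φ`,
and `E e^{c∫|p|} ≤ C_θ e^{θH(z)}` by CEHR (3.4)]; and the EXPECTED-FALSE mutation (SWMᵘ)
`SkeletonWeightMomentsLevelUniform` («`∃ m₁ ∀ q`»: at a fixed finite level the Gram determinant is a
smooth functional of finitely many Gaussians with a finite small-ball exponent (Carbery–Wright), so
inverse moments exist only up to an order growing with `m`) — recorded for the MustFail / BC7
probes, never staffed.  LOSS PROFILE: sub-exponential `e^{εH(z)}`, `∀ ε > 0` (weaker than the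
polynomial `(1+H(z))^C` of memo g76 §4; the Jacobian factors `e^{C∫₀ˢ|p_t|dt}` are genuinely
`e^{C√H}`-sized; the two-rate windows `θ < θ₁`, `θ₁ < θ₂` of (G1)/(G1*) absorb any such loss).
The glues (SWM) ∧ (JM) ⟹ (G1), (SWM) ⟹ (G1*) are parts S–V of the plan (memo NODE-g77.md §3:
skeleton law, finite-dimensional Gaussian IBP for `C¹_c` functions, the two truncations, Hölder
with `p ↓ 1`, the `κ`-defect by dominated convergence, and for (G1) the Lipschitz passage from
`C_c^∞` to measurable observables of part Rᵇ).  No proof holes, no new instance / notation.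
References: S. Kusuoka, D. Stroock, J. Fac. Sci. Univ. Tokyo 32 (1985) 1 (Thm 2.19: inverse
moments of the Malliavin matrix under Hörmander); J. Norris, Sém. Probab. XX, LNM 1204 (1986) 101;
D. Nualart, The Malliavin Calculus and Related Topics (2006), Prop. 1.3.1 / 1.5.4 (`δ`, Meyer),
§2.3; F.-Y. Wang, X. Zhang, J. Math. Pures Appl. 99 (2013) 726 = arXiv:1107.0096, Thm 1.1 (the
`N = 2` rung: noise acting invertibly on the second block); J.-P. Eckmann, M. Hairer, Comm. Math.
Phys. 212 (2000) 105, §3; A. Carbery, J. Wright, Math. Res. Lett. 8 (2001) 233; N. Cuneo,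
J.-P. Eckmann, M. Hairer, L. Rey-Bellet, Electron. J. Probab. 23 (2018), eq. (3.4).
-/

noncomputable section

namespace Summit.AtomisticToContinuum.FouriersLaw.Theorems.ExtensiveSnapshotIrreversibility.EnergyWindow

open MeasureTheory ProbabilityTheory Filter Topology Real unitInterval Set
open scoped ENNReal NNReal Matrix ContDiff
open Literature.MathematicalPhysics.KineticTheory.HeatConduction
open Literature.Probability.Process Literature.Analysis.ODE

/-! ## 1. (I-s1) The skeleton flow map at time `s ∈ [0, 1]` -/

/-- The **skeleton flow map at time `s`**: the state at time `s` of the pinned chain (baths at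
`T_L`, `T_R`) started at `z` and driven by the skeleton noise of (remainder `r`, level-`m` skeleton
`x`).  The tree's `skelFlowMap` is the case `s = 1`. [folklore] -/
def skelFlowMapAt (ω₂ lam β γ : ℝ) (N : ℕ) (T_L T_R : ℝ) (s : ℝ) (m : ℕ) (z : PhaseSpace N)
    (r : WienerPair) (x : PairSkeleton m) : PhaseSpace N :=
  (pinnedChain ω₂ lam β γ).chainFlow N z (skelNoise ω₂ lam β γ N T_L T_R m r x) s

/-- At `s = 1` the skeleton flow map is the tree's `skelFlowMap`. [folklore] -/
theorem skelFlowMapAt_one (ω₂ lam β γ : ℝ) (N : ℕ) (T_L T_R : ℝ) (m : ℕ) (z : PhaseSpace N)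
    (r : WienerPair) (x : PairSkeleton m) :
    skelFlowMapAt ω₂ lam β γ N T_L T_R 1 m z r x = skelFlowMap ω₂ lam β γ N T_L T_R m z r x := rfl

/-- The constant-curve embedding `z ↦ (τ ↦ z)` of phase space into `C([0,1], PhaseSpace N)`, a
continuous linear map (finite-dimensional source). [folklore] -/
def constCurve (N : ℕ) : PhaseSpace N →L[ℝ] C(I, PhaseSpace N) :=
  LinearMap.toContinuousLinearMap
    { toFun := fun z => ContinuousMap.const I z
      map_add' := fun _ _ => ContinuousMap.ext fun _ => rfl
      map_smul' := fun _ _ => ContinuousMap.ext fun _ => rfl }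

/-- Unfolding `constCurve`. [folklore] -/
@[simp] theorem constCurve_apply (N : ℕ) (z : PhaseSpace N) (τ : I) : constCurve N z τ = z := rfl

/-- The forcing curve `g(z, x)(τ) = z + (0, η₀ τ + (H x) τ)` is affine in the pair (starting point,
forcing parameter): `g(z, x) = const z + (g(0, ·)-base + lift (H x))`. [folklore] -/
theorem forcingCurve_eq_constCurve_add {N : ℕ} (z : PhaseSpace N) {η₀ : ℝ → Fin N → ℝ}
    (hη₀ : Continuous η₀) {X : Type*} [NormedAddCommGroup X] [NormedSpace ℝ X]
    (H : X →L[ℝ] C(I, Fin N → ℝ)) (x : X) :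
    forcingCurve z hη₀ H x = constCurve N z + (baseForcingCurve 0 hη₀ + momentumLift N (H x)) := by
  apply ContinuousMap.ext
  intro τ
  simp only [forcingCurve, baseForcingCurve, ContinuousMap.add_apply, ContinuousMap.coe_mk,
    constCurve_apply, zero_add, add_assoc]

section SkelAt

variable {ω₂ lam β γ : ℝ} (hω : 0 < ω₂) (hl : 0 ≤ lam) (hβ : 0 ≤ β) (hγ : 0 ≤ γ) (N : ℕ)
  (T_L T_R : ℝ)

include hω hl hβ hγ

/-- **The solution map at time `s ∈ [0, 1]` is the skeleton flow map at time `s` of (skeleton,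
remainder) of the path**, at every level `m` (`pinnedChain_solMap_eqOn_skelFlow`). [folklore] -/
theorem pinnedChain_solMap_eq_skelFlowMapAt {s : ℝ} (hs : s ∈ Icc (0 : ℝ) 1) (m : ℕ)
    (z : PhaseSpace N) (wp : WienerPair) :
    (pinnedChain ω₂ lam β γ).solMap N T_L T_R s z (pairPath wp) =
      skelFlowMapAt ω₂ lam β γ N T_L T_R s m z (pairRem m wp) (pairSkel m wp) := by
  have h := pinnedChain_solMap_eqOn_skelFlow hω hl hβ hγ N T_L T_R m z wp hs
  exact h

/-- The skeleton flow map at time `s ∈ [0, 1]` is the evaluation at `s` of the solution curve of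
`LangevinChainVariational` (perturbed-noise family with base noise the remainder's bath noise and
perturbation the skeleton forcing). [folklore] -/
theorem skelFlowMapAt_eq_solCurve {s : ℝ} (hs : s ∈ Icc (0 : ℝ) 1) (m : ℕ) (z : PhaseSpace N)
    (r : WienerPair) (x : PairSkeleton m) :
    skelFlowMapAt ω₂ lam β γ N T_L T_R s m z r x =
      pinnedChainSolCurve hω hl hβ hγ N z (continuous_chainNoise_rem ω₂ lam β γ N T_L T_R r)
        (skelForcing N m (ampL ω₂ lam β γ T_L) (ampR ω₂ lam β γ T_R)) x ⟨s, hs⟩ := rfl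

/-- **The skeleton flow map at time `s ∈ [0, 1]` is `C^∞` in the skeleton.** [folklore] -/
theorem contDiff_skelFlowMapAt {s : ℝ} (hs : s ∈ Icc (0 : ℝ) 1) (m : ℕ) (z : PhaseSpace N)
    (r : WienerPair) : ContDiff ℝ ∞ (skelFlowMapAt ω₂ lam β γ N T_L T_R s m z r) := by
  have h := (ContinuousMap.evalCLM ℝ (⟨s, hs⟩ : I)).contDiff.comp
    (contDiff_pinnedChainSolCurve hω hl hβ hγ N z
      (continuous_chainNoise_rem ω₂ lam β γ N T_L T_R r)
      (skelForcing N m (ampL ω₂ lam β γ T_L) (ampR ω₂ lam β γ T_R)))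
  exact h

/-- The derivative of the time-`s` skeleton flow map is the evaluation at `s` of the derivative of
the solution curve. [folklore] -/
theorem hasFDerivAt_skelFlowMapAt {s : ℝ} (hs : s ∈ Icc (0 : ℝ) 1) (m : ℕ) (z : PhaseSpace N)
    (r : WienerPair) (x : PairSkeleton m) :
    HasFDerivAt (skelFlowMapAt ω₂ lam β γ N T_L T_R s m z r)
      ((ContinuousMap.evalCLM ℝ (⟨s, hs⟩ : I)).comp
        (fderiv ℝ (pinnedChainSolCurve hω hl hβ hγ N z
          (continuous_chainNoise_rem ω₂ lam β γ N T_L T_R r)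
          (skelForcing N m (ampL ω₂ lam β γ T_L) (ampR ω₂ lam β γ T_R))) x)) x := by
  have hd : DifferentiableAt ℝ (pinnedChainSolCurve hω hl hβ hγ N z
      (continuous_chainNoise_rem ω₂ lam β γ N T_L T_R r)
      (skelForcing N m (ampL ω₂ lam β γ T_L) (ampR ω₂ lam β γ T_R))) x :=
    (contDiff_pinnedChainSolCurve hω hl hβ hγ N z _ _).differentiable (by simp) x
  exact (ContinuousMap.evalCLM ℝ (⟨s, hs⟩ : I)).hasFDerivAt.comp x hd.hasFDerivAt

/-- **The derivative of the time-`s` skeleton flow map in the direction `δ` is the variational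
solution at time `s`**, `D_x E^{s}(x) δ = w_δ(s)`. [folklore] -/
theorem fderiv_skelFlowMapAt_apply {s : ℝ} (hs : s ∈ Icc (0 : ℝ) 1) (m : ℕ) (z : PhaseSpace N)
    (r : WienerPair) (x δ : PairSkeleton m) :
    fderiv ℝ (skelFlowMapAt ω₂ lam β γ N T_L T_R s m z r) x δ =
      pinnedChainVariation hω hl hβ hγ N z (continuous_chainNoise_rem ω₂ lam β γ N T_L T_R r)
        (skelForcing N m (ampL ω₂ lam β γ T_L) (ampR ω₂ lam β γ T_R)) x δ s := by
  rw [(hasFDerivAt_skelFlowMapAt hω hl hβ hγ N T_L T_R hs m z r x).fderiv,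
    ContinuousLinearMap.comp_apply, ContinuousMap.evalCLM_apply, pinnedChainVariation,
    IccExtend_of_mem _ _ hs]

/-- **The time-`s` skeleton flow map is jointly measurable** in (skeleton, remainder).
[folklore] -/
theorem measurable_skelFlowMapAt (s : ℝ) (m : ℕ) (z : PhaseSpace N) :
    Measurable fun p : PairSkeleton m × WienerPair =>
      skelFlowMapAt ω₂ lam β γ N T_L T_R s m z p.2 p.1 := by
  have hG : ∀ t, Measurable fun p : PairSkeleton m × WienerPair =>
      skelNoise ω₂ lam β γ N T_L T_R m p.2 p.1 t := by
    intro t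
    have h1 : Measurable fun p : PairSkeleton m × WienerPair =>
        chainNoise N (ampL ω₂ lam β γ T_L) (ampR ω₂ lam β γ T_R) p.2 t :=
      (measurable_chainNoise _ _ t).comp measurable_snd
    have h2 : Measurable fun p : PairSkeleton m × WienerPair =>
        IccExtend zero_le_one (skelForcing N m (ampL ω₂ lam β γ T_L) (ampR ω₂ lam β γ T_R) p.1)
          t := by
      have hx : Continuous fun x : PairSkeleton m =>
          (skelForcing N m (ampL ω₂ lam β γ T_L) (ampR ω₂ lam β γ T_R) x)
            (projIcc 0 1 zero_le_one t) :=
        (continuous_eval_const (projIcc 0 1 zero_le_one t)).comp (skelForcing N m _ _).continuous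
      exact hx.measurable.comp measurable_fst
    exact h1.add h2
  have h := pinnedChain_measurable_chainFlow hω hl hβ hγ N
    (X := fun _ : PairSkeleton m × WienerPair => z)
    (G := fun p : PairSkeleton m × WienerPair => skelNoise ω₂ lam β γ N T_L T_R m p.2 p.1)
    measurable_const (fun p => continuous_perturbedNoise (continuous_chainNoise _ _ p.2) _ p.1) hG s
  exact h

/-- **The directional derivatives of the time-`s` skeleton flow map are jointly measurable**
(pointwise limits of difference quotients, `measurable_fderiv_apply_of_param`). [folklore] -/
theorem measurable_fderiv_skelFlowMapAt_apply {s : ℝ} (hs : s ∈ Icc (0 : ℝ) 1) (m : ℕ)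
    (z : PhaseSpace N) (δ : PairSkeleton m) :
    Measurable fun p : PairSkeleton m × WienerPair =>
      fderiv ℝ (skelFlowMapAt ω₂ lam β γ N T_L T_R s m z p.2) p.1 δ := by
  have hE := measurable_skelFlowMapAt hω hl hβ hγ N T_L T_R s m z
  have hd : ∀ (r : WienerPair) (x : PairSkeleton m),
      DifferentiableAt ℝ (fun y => skelFlowMapAt ω₂ lam β γ N T_L T_R s m z r y) x := fun r x =>
    (contDiff_skelFlowMapAt hω hl hβ hγ N T_L T_R hs m z r).differentiable (by simp) x
  exact measurable_fderiv_apply_of_param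
    (fun p : PairSkeleton m × WienerPair => skelFlowMapAt ω₂ lam β γ N T_L T_R s m z p.2 p.1) hE hd
    δ

/-- **Joint smooth dependence of the solution curve on (starting point, forcing parameter).**
The family `(z, x) ↦ (solution curve on [0,1] of the chain started at z, driven by η₀ + H x)` is
`C^∞` as a map `PhaseSpace N × X → C([0,1], PhaseSpace N)`: the implicit function theorem of
`ForcedSmoothDependence` (`contDiffAt_forcedSolution_family`) with parameter space
`PhaseSpace N × X`, the forcing curve being affine in the pair (`forcingCurve_eq_constCurve_add`)
and the parametric Robbin map seeing the parameter only through the forcing curve. [folklore] -/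
theorem contDiff_pinnedChainSolCurve_uncurry {η₀ : ℝ → Fin N → ℝ} (hη₀ : Continuous η₀)
    {X : Type} [NormedAddCommGroup X] [NormedSpace ℝ X] [CompleteSpace X]
    (H : X →L[ℝ] C(I, Fin N → ℝ)) :
    ContDiff ℝ ∞ fun p : PhaseSpace N × X => pinnedChainSolCurve hω hl hβ hγ N p.1 hη₀ H p.2 := by
  set g : PhaseSpace N × X → C(I, PhaseSpace N) := fun p => forcingCurve p.1 hη₀ H p.2 with hg_def
  have hg : ContDiff ℝ ∞ g := by
    have h1 : ContDiff ℝ ∞ fun p : PhaseSpace N × X => constCurve N p.1 :=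
      (constCurve N).contDiff.comp contDiff_fst
    have h2 : ContDiff ℝ ∞ fun p : PhaseSpace N × X => momentumLift N (H p.2) :=
      ((momentumLift N).comp H).contDiff.comp contDiff_snd
    have hg' : g = fun p => constCurve N p.1 + (baseForcingCurve 0 hη₀ + momentumLift N (H p.2)) :=
      funext fun p => forcingCurve_eq_constCurve_add p.1 hη₀ H p.2
    rw [hg']
    exact h1.add (contDiff_const.add h2)
  set S : PhaseSpace N × X → C(I, PhaseSpace N) :=
    fun p => pinnedChainSolCurve hω hl hβ hγ N p.1 hη₀ H p.2 with hS_def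
  have hS : ∀ p, forcedRobbinMap ((pinnedChain ω₂ lam β γ).drift N) g (p, S p) = 0 := fun p =>
    forcedRobbinMap_pinnedChainSolCurve hω hl hβ hγ N p.1 hη₀ H p.2
  have huniq : ∀ p α, forcedRobbinMap ((pinnedChain ω₂ lam β γ).drift N) g (p, α) = 0 → α = S p :=
    fun p α h => eq_pinnedChainSolCurve_of_forcedRobbinMap_eq_zero hω hl hβ hγ N p.1 hη₀ H p.2 α h
  exact contDiff_iff_contDiffAt.2 fun p =>
    contDiffAt_forcedSolution_family (n := ⊤) (pinnedChain_contDiff_drift ω₂ lam β γ N) hg le_top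
      hS huniq p

/-- **The time-`s` skeleton flow map is jointly `C^∞` in (starting point, skeleton)**, for every
remainder. [folklore] -/
theorem contDiff_skelFlowMapAt_uncurry {s : ℝ} (hs : s ∈ Icc (0 : ℝ) 1) (m : ℕ)
    (r : WienerPair) :
    ContDiff ℝ ∞ fun p : PhaseSpace N × PairSkeleton m =>
      skelFlowMapAt ω₂ lam β γ N T_L T_R s m p.1 r p.2 := by
  have h := (ContinuousMap.evalCLM ℝ (⟨s, hs⟩ : I)).contDiff.comp
    (contDiff_pinnedChainSolCurve_uncurry hω hl hβ hγ N
      (continuous_chainNoise_rem ω₂ lam β γ N T_L T_R r)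
      (skelForcing N m (ampL ω₂ lam β γ T_L) (ampR ω₂ lam β γ T_R)))
  exact h

/-- The time-`s` skeleton flow map is `C^∞` in the starting point, for every (remainder,
skeleton). [folklore] -/
theorem contDiff_skelFlowMapAt_left {s : ℝ} (hs : s ∈ Icc (0 : ℝ) 1) (m : ℕ) (r : WienerPair)
    (x : PairSkeleton m) :
    ContDiff ℝ ∞ fun z : PhaseSpace N => skelFlowMapAt ω₂ lam β γ N T_L T_R s m z r x := by
  have h1 := contDiff_skelFlowMapAt_uncurry hω hl hβ hγ N T_L T_R hs m r
  have h0 : ContDiff ℝ ∞ fun z : PhaseSpace N => ((z, x) : PhaseSpace N × PairSkeleton m) :=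
    contDiff_prodMk_left x
  have h2 := h1.comp h0
  exact h2

/-- **The solution map at time `s ∈ [0, 1]` is `C^∞` in the starting point for EVERY driving
path** (not only almost surely): `z ↦ Φ_s(z, pairPath wp)`. [folklore] -/
theorem contDiff_solMap_pairPath {s : ℝ} (hs : s ∈ Icc (0 : ℝ) 1) (wp : WienerPair) :
    ContDiff ℝ ∞ fun z : PhaseSpace N =>
      (pinnedChain ω₂ lam β γ).solMap N T_L T_R s z (pairPath wp) := by
  have h := contDiff_skelFlowMapAt_left hω hl hβ hγ N T_L T_R hs 0 (pairRem 0 wp) (pairSkel 0 wp)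
  have hfun :
      (fun z : PhaseSpace N => (pinnedChain ω₂ lam β γ).solMap N T_L T_R s z (pairPath wp)) =
      fun z => skelFlowMapAt ω₂ lam β γ N T_L T_R s 0 z (pairRem 0 wp) (pairSkel 0 wp) :=
    funext fun z => pinnedChain_solMap_eq_skelFlowMapAt hω hl hβ hγ N T_L T_R hs 0 z wp
  rw [hfun]
  exact h

end SkelAt

end Summit.AtomisticToContinuum.FouriersLaw.Theorems.ExtensiveSnapshotIrreversibility.EnergyWindow

end
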